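import Summits.AnomalousDissipation.AnomalousDissipation.Theorems.SolenoidalFractalHomogenisationLagrangianStepCellClauseCuts
import HarnessLib

/-!
# K1L `LagrangianRenormalisationStep` (stmt-AnomalousDissipation-24912) — typed RE-CUT CANDIDATE for clause (F) of `CellEnergyClauses`
# (answer to lead-k1l-onelevel-p1 FINDING F-lead-1, STATUS 2026-08-28T12:55:06Z); planner ad-ideate-p4 g9; crux workfile, NOT a registered line.

F-lead-1: the UNIFORM-IN-`T` slow leakage `lowEnergy L (u t) ≤ C·(cL²/(n²ν²))·‖F‖²` of clause (F) cannot follow from flux-MAGNITUDE energy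
methods — the landed block identities (p634148) give, for `x = √(slow energy)`, `y = √(complement energy)`, only the inclusion `x' ≤ 2ηy`,
`y' ≤ −λy + 2ηx` (`η = 3kL/(2n)`, `λ = π²ν·lo/Λ`, cell time), which contains `e^{4η²t/λ}`; energy-provable (FastBlock machinery p634526) is the
WINDOW-LOCAL form with growth factor `exp(C'·(L²/(n²ν))·t)`, `C' = 9k²Λ/(π²lo)` (`4η²/λ = 9k²L²Λ/(π²lo·n²ν)`).  This file TYPES that re-cut and
records the bookkeeping check the lead asked for.

* `CellEnergyClausesWNoE` / `CellEnergyClausesW` — `CellEnergyClausesNoE` / `CellEnergyClauses` (p629134 / OneLevelDefs) VERBATIM except that the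
  leakage conjunct of (F) reads `lowEnergy L (u t) ≤ C * (c * L ^ 2 / ((n:ℝ) ^ 2 * ν ^ 2)) * Real.exp (C * (L ^ 2 / ((n:ℝ) ^ 2 * ν)) * t) * ∫‖F‖²`
  (ONE constant `C` for prefactor and rate: take the max).  Clause (C) untouched (it is PROVED uniformly in `T`: `cell_corrector_content` p634914).
* `cellEnergyClausesW_of_noE` — the energy conjunct is free (`ae_energy_le_datum`), exactly as `cellEnergyClauses_of_noE`.
* `cellEnergyClausesW_of_cellEnergyClauses` — (F) ⇒ (F_T) (`exp ≥ 1`): the re-cut WEAKENS `stub_cellEnergyT`'s conclusion and STRENGTHENS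
  `stub_oneLevelL`'s hypothesis, so adopting it is a consent matter for the lead (who proposed it) and a text change of both stubs + the
  by-name glue (`CellEnergyClauses ↦ CellEnergyClausesW` in `hone`/`hEcl`; my `chainLower_of_pieces_{I,S,IS}` pass the clause through untouched).
* `activeBand_exponent_le` (+ `_T5`, `activeBand_growth_le`, `slowBandEdge_exponent_eq`) — THE BOOKKEEPING CHECK (tenure D24-4 (c)) as lemmas
  of real arithmetic.  Write `r = N (m+1)/N m = s¹⁶` (`s = r^{1/16} = ρ^{-1/16} ≥ 1`).  On the ACTIVE band of the skeleton's own plan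
  (`stub_oneLevelL` docstring: «slow modes |ℓ| ≤ N_m ρ^{-1/8} by (T3)», i.e. `L = N m·s²`, `n = N (m+1) = s¹⁶·N m` as in OneLevelScales p630617:
  `ν = cellVisc (m+1)`, cell time `a (m+1)·t`, cell period `P/ν`, `P = M·W.period`), under (T3) ALONE (`K·r^{1/4} ≤ r·cellVisc`, i.e.
  `ν ≥ Kρ^{3/4}`; (T2) unused) and within `J` cell periods (`t ≤ J·P/ν`): `L²/(n²ν)·t ≤ J·P·ρ^{1/4}/K²` (`N m` cancels) — per period `a = 1/4`,
  per (T5)-unit window (`J = ρ^{-1/16}`) `P·ρ^{3/16}/K²`, `a = 3/16` (confirms the lead); so `exp(C·(L²/(n²ν))·t) ≤ exp(C·J·P·ρ^{1/4}/K²) → 1`,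
  absorbed into `m⋆` (e.g. `≤ 2` beyond `m⋆`) for any `J ≪ ρ^{-1/4}`.  At the clause's band EDGE `L = nν/K` the variable part is `ν t/K² ~ J·P/K²`
  with no power of `ρ`: NOT small (`slowBandEdge_exponent_eq`).
CHECK RESULT (for the lead / tenure, three points).  (i) TIME-LOCALITY IS FORCED ANYWAY: `cellField W M hM ν hν n` is the carrier's drift (in the
Lagrangian frame of `b_{≤m}`) only INSIDE one refresh window of level `m+1` (`IsInserted`: frames reset at `j·refresh (m+1)`), so no step of
oneLevelL can apply (F) across windows; per window the datum splits LINEARLY into slow + fluctuation parts ((C) for the first, (F_T) for the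
second), and the number of windows enters only through sums of per-window leakages — each `≤ 2C·(cL²/(n²ν²))·(fluctuation energy at window
start) ≤ 2C·(cL²/(n²ν²))·E₀`-type terms; whether their SUM over the `(1/2,1)·(cell-time scale)/T_w` windows of the level is still `o(1)·drop` is
the lead's existing transient bookkeeping ((T5) `refresh transients ≤ ρ^{1/16}`), unchanged by the re-cut.  (ii) BAND: (F_T) serves ONLY the
active band `L ≤ N m·ρ^{-1/8}`; on the full slow band allowed by the clause (`L ≤ nν/K`) the exponent is `O(P·ρ^{-1/16})`, NOT small — so if
any step of the oneLevelL plan feeds (F) an `L` above the active band (the INTERMEDIATE band `N m ρ^{-1/8} < |ℓ| < N (m+1)/2`), that step must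
instead use plain dissipation (those modes carry no homogenisation claim; their decay rate at level `m+1` is ≥ `4π²·kbar (m+1)·lo·N m²ρ^{-1/4}` per
physical unit time, which is what makes them negligible in AV §5.3) — the lead should confirm no such use exists; the typed clause keeps `L` free,
so nothing in the TEXT depends on the answer.  (iii) WINDOW LENGTH: the exponent needs the cell time to stay `≤ J·P/ν` with `J ≪ ρ^{-1/4}`; (T5) is only a LOWER bound on
`refresh (m+1)` (≥ `ρ^{-1/16}` periods) and the template's only upper bound — strain clause (S) of `LPermissible` with (T4):
`refresh (m+1) ≤ θ (m+1)/Σ_{i≤m} a i ≤ θ₀ρ^{1/16}/Σ_{i≤m} a i` (physical time) — is not comparable to the cell period in general; this costs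
nothing: `cellField` is `P/ν`-periodic in cell time and (W1) makes every refresh window a whole number of periods, so the consumer applies (F_T) per
SUB-WINDOW of `J` whole periods (restart at a period multiple = the same clause by periodicity, the restart datum being in the energy class by
uniqueness p607939; datum split linearly into slow + fluctuation parts, (C) + (F_T) — the same split the plan already makes at each refresh time), choosing e.g. `J = ρ^{-1/16}`; the per-sub-window leak `≤ 2C·(cL²/(n²ν²))·(fluctuation energy at restart) ≤ 2C·c·ρ^{1/4}/K²·E₀` then
accumulates ADDITIVELY in the number of sub-windows — that sum (and the refresh transients) is the lead's bookkeeping (b), untouched by this file.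
Nothing here proves the crux, Onsager's conjecture or anomalous dissipation; no sorries.
-/

set_option linter.dupNamespace false
set_option linter.unusedVariables false

namespace Summit.AnomalousDissipation.AnomalousDissipation.Cruxes.LagrangianRenormalisationStep.CellEnergyFRecut

open Literature.Analysis Literature.Analysis.FluidPDE Literature.Analysis.FunctionSpaces
open MeasureTheory Set Filter
open scoped ENNReal NNReal InnerProductSpace
open Summit.AnomalousDissipation.AnomalousDissipation.Theorems.SolenoidalFractalHomogenisation.LagrangianStep

noncomputable section

/-- (F_T) + (C) WITHOUT the energy conjunct — candidate conclusion of `stub_cellEnergyT` (re-cut of `CellEnergyClausesNoE`, p629134): the slow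
leakage from fluctuation data carries the window-local growth factor `exp(C·(L²/(n²ν))·t)`. -/
def CellEnergyClausesWNoE {k : ℕ} (W : LatticeShear.LatticeWord k) (M : ℝ) (hM : 0 < M) (c : ℝ) (lo hi Λ β C ν₀ K : ℝ) : Prop :=
      ∀ ν, ∀ hν : ν ∈ Set.Ioo 0 ν₀, ∀ n : ℕ, ∀ 𝔸 : Torus.Visc4 (Fin 3),
        Torus.OddSmall 𝔸 (ν * β) → (∃ lam ∈ Set.Icc (1:ℝ) Λ, Torus.NearIso 𝔸 (ν * (lo / lam)) (ν * (hi * lam))) →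
        (∀ L > (0:ℝ), L * (⌈K / ν⌉₊ : ℝ) ≤ n → ∀ F : VF, IsDatum F →
            (∀ k' : Fin 3 → ℤ, ‖Torus.latticeVec k'‖ < (n:ℝ) / 2 → ∀ i, modeCoeff k' F i = 0) →
            ∀ T > (0:ℝ), ∀ u : ℝ → VF, Torus.IsWeakTensorPassiveVectorOn 0 T ((1 / (n:ℝ) ^ 2) • 𝔸) (cellField W M hM ν hν.1 n) F u →
              ∀ᵐ t ∂(volume.restrict (Ioo 0 T)),
                lowEnergy L (u t) ≤ C * (c * L ^ 2 / ((n:ℝ) ^ 2 * ν ^ 2)) * Real.exp (C * (L ^ 2 / ((n:ℝ) ^ 2 * ν)) * t) * ∫ x, ‖F x‖ ^ 2) ∧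
        ∀ ℓ : Fin 3 → ℤ, ℓ ≠ 0 → ‖Torus.latticeVec ℓ‖ * (⌈K / ν⌉₊ : ℝ) ≤ n →
        ∀ p : EuclideanSpace ℝ (Fin 3), ‖p‖ = 1 → ⟪p, Torus.latticeVec ℓ⟫_ℝ = 0 →
        ∀ T > (0:ℝ), ∀ w : ℝ → VF,
            Torus.IsWeakTensorPassiveVectorOn 0 T ((1 / (n:ℝ) ^ 2) • 𝔸) (cellField W M hM ν hν.1 n) (fun x => (UnitAddTorus.mFourier ℓ x).re • p) w →
            ∀ᵐ t ∂(volume.restrict (Ioo 0 T)),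
              ∫ x, ‖w t x‖ ^ 2 - lowEnergy ((n:ℝ) / 2) (w t)
                  ≤ C * (c * ‖Torus.latticeVec ℓ‖ ^ 2 / ((n:ℝ) ^ 2 * ν ^ 2)) * ∫ x, ‖(UnitAddTorus.mFourier ℓ x).re • p‖ ^ 2

/-- (F_T) + (C) WITH the energy conjunct — candidate hypothesis text of `stub_oneLevelL` (re-cut of `CellEnergyClauses`, OneLevelDefs). -/
def CellEnergyClausesW {k : ℕ} (W : LatticeShear.LatticeWord k) (M : ℝ) (hM : 0 < M) (c : ℝ) (lo hi Λ β C ν₀ K : ℝ) : Prop :=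
      ∀ ν, ∀ hν : ν ∈ Set.Ioo 0 ν₀, ∀ n : ℕ, ∀ 𝔸 : Torus.Visc4 (Fin 3),
        Torus.OddSmall 𝔸 (ν * β) → (∃ lam ∈ Set.Icc (1:ℝ) Λ, Torus.NearIso 𝔸 (ν * (lo / lam)) (ν * (hi * lam))) →
        (∀ L > (0:ℝ), L * (⌈K / ν⌉₊ : ℝ) ≤ n → ∀ F : VF, IsDatum F →
            (∀ k' : Fin 3 → ℤ, ‖Torus.latticeVec k'‖ < (n:ℝ) / 2 → ∀ i, modeCoeff k' F i = 0) →
            ∀ T > (0:ℝ), ∀ u : ℝ → VF, Torus.IsWeakTensorPassiveVectorOn 0 T ((1 / (n:ℝ) ^ 2) • 𝔸) (cellField W M hM ν hν.1 n) F u →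
              ∀ᵐ t ∂(volume.restrict (Ioo 0 T)),
                ∫ x, ‖u t x‖ ^ 2 ≤ ∫ x, ‖F x‖ ^ 2 ∧
                lowEnergy L (u t) ≤ C * (c * L ^ 2 / ((n:ℝ) ^ 2 * ν ^ 2)) * Real.exp (C * (L ^ 2 / ((n:ℝ) ^ 2 * ν)) * t) * ∫ x, ‖F x‖ ^ 2) ∧
        ∀ ℓ : Fin 3 → ℤ, ℓ ≠ 0 → ‖Torus.latticeVec ℓ‖ * (⌈K / ν⌉₊ : ℝ) ≤ n →
        ∀ p : EuclideanSpace ℝ (Fin 3), ‖p‖ = 1 → ⟪p, Torus.latticeVec ℓ⟫_ℝ = 0 →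
        ∀ T > (0:ℝ), ∀ w : ℝ → VF,
            Torus.IsWeakTensorPassiveVectorOn 0 T ((1 / (n:ℝ) ^ 2) • 𝔸) (cellField W M hM ν hν.1 n) (fun x => (UnitAddTorus.mFourier ℓ x).re • p) w →
            ∀ᵐ t ∂(volume.restrict (Ioo 0 T)),
              ∫ x, ‖w t x‖ ^ 2 - lowEnergy ((n:ℝ) / 2) (w t)
                  ≤ C * (c * ‖Torus.latticeVec ℓ‖ ^ 2 / ((n:ℝ) ^ 2 * ν ^ 2)) * ∫ x, ‖(UnitAddTorus.mFourier ℓ x).re • p‖ ^ 2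

/-- The energy conjunct is free (Temam energy inequality for every weak cell solution, `ae_energy_le_datum`). -/
theorem cellEnergyClausesW_of_noE {k : ℕ} {W : LatticeShear.LatticeWord k} {M : ℝ} {hM : 0 < M} {c : ℝ} {lo hi Λ β C ν₀ K : ℝ}
    (hlo : 0 < lo) (hK : 0 < K) (h : CellEnergyClausesWNoE W M hM c lo hi Λ β C ν₀ K) : CellEnergyClausesW W M hM c lo hi Λ β C ν₀ K := by
  intro ν hν n 𝔸 hodd hwin'
  obtain ⟨hFcl, hCcl⟩ := h ν hν n 𝔸 hodd hwin'
  refine ⟨fun L hL hLn F hF hmodes T hT u hu => ?_, hCcl⟩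
  have h1 := ae_energy_le_datum (hM := hM) hlo hν.1 (one_le_of_band hL hK hν.1 hLn) hwin' hF hu
  have h2 := hFcl L hL hLn F hF hmodes T hT u hu
  filter_upwards [h1, h2] with t ht1 ht2
  exact ⟨ht1, ht2⟩

/-- (F) ⇒ (F_T): the re-cut is a WEAKENING of the registered clauses (`C ≥ 0`, `c ≥ 0`; `exp ≥ 1` on `t > 0`). -/
theorem cellEnergyClausesW_of_cellEnergyClauses {k : ℕ} {W : LatticeShear.LatticeWord k} {M : ℝ} {hM : 0 < M} {c : ℝ} {lo hi Λ β C ν₀ K : ℝ}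
    (hc : 0 ≤ c) (hC : 0 ≤ C) (h : CellEnergyClauses W M hM c lo hi Λ β C ν₀ K) : CellEnergyClausesW W M hM c lo hi Λ β C ν₀ K := by
  intro ν hν n 𝔸 hodd hwin'
  obtain ⟨hFcl, hCcl⟩ := h ν hν n 𝔸 hodd hwin'
  refine ⟨fun L hL hLn F hF hmodes T hT u hu => ?_, hCcl⟩
  have h2 := hFcl L hL hLn F hF hmodes T hT u hu
  filter_upwards [h2, ae_restrict_mem measurableSet_Ioo] with t ht htI
  refine ⟨ht.1, ht.2.trans ?_⟩
  have hA : 0 ≤ C * (c * L ^ 2 / ((n:ℝ) ^ 2 * ν ^ 2)) := mul_nonneg hC (by positivity)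
  have hE : 0 ≤ ∫ x, ‖F x‖ ^ 2 := integral_nonneg fun x => by positivity
  have hexp : 1 ≤ Real.exp (C * (L ^ 2 / ((n:ℝ) ^ 2 * ν)) * t) := by
    rw [← Real.exp_zero]
    exact Real.exp_le_exp.mpr (mul_nonneg (mul_nonneg hC (by have := hν.1; positivity)) htI.1.le)
  calc C * (c * L ^ 2 / ((n:ℝ) ^ 2 * ν ^ 2)) * ∫ x, ‖F x‖ ^ 2
      = (C * (c * L ^ 2 / ((n:ℝ) ^ 2 * ν ^ 2)) * 1) * ∫ x, ‖F x‖ ^ 2 := by rw [mul_one]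
    _ ≤ (C * (c * L ^ 2 / ((n:ℝ) ^ 2 * ν ^ 2)) * Real.exp (C * (L ^ 2 / ((n:ℝ) ^ 2 * ν)) * t)) * ∫ x, ‖F x‖ ^ 2 :=
        mul_le_mul_of_nonneg_right (mul_le_mul_of_nonneg_left hexp hA) hE

/-- **THE BOOKKEEPING CHECK (active band, `J` cell periods).**  With `s = (N (m+1)/N m)^{1/16} ≥ 1` (`ρ = s⁻¹⁶`), slow cut-off
`L = N m·s²` (= `N m·ρ^{-1/8}`, the ACTIVE band of `stub_oneLevelL`), `n = N (m+1) = s¹⁶·N m` cells (OneLevelScales: `ν = cellVisc (m+1)`,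
cell time `a (m+1)·t`, cell period `P/ν` with `P = M·W.period`), (T3) in the form `K·s⁴ ≤ s¹⁶·ν` (i.e. `ν ≥ K·ρ^{3/4}`; (T2) is NOT used), and a
cell time `t ≤ J·P/ν` (`J` periods): the exponent's variable part satisfies `L²/(n²ν)·t ≤ J·P/(K²s⁴) = J·P·ρ^{1/4}/K²` (`N m` cancels). -/
theorem activeBand_exponent_le {s Nm K ν P J t : ℝ} (hs : 1 ≤ s) (hNm : 0 < Nm) (hK : 0 < K) (hν : 0 < ν) (hP : 0 ≤ P) (hJ : 0 ≤ J)
    (hT3 : K * s ^ 4 ≤ s ^ 16 * ν) (ht : t ≤ J * P / ν) :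
    (Nm * s ^ 2) ^ 2 / ((s ^ 16 * Nm) ^ 2 * ν) * t ≤ J * P / (K ^ 2 * s ^ 4) := by
  have hs0 : 0 < s := lt_of_lt_of_le one_pos hs
  have hKν : K / s ^ 12 ≤ ν := by
    rw [div_le_iff₀ (by positivity)]
    have h' : K * s ^ 4 ≤ (ν * s ^ 12) * s ^ 4 := by
      calc K * s ^ 4 ≤ s ^ 16 * ν := hT3
        _ = (ν * s ^ 12) * s ^ 4 := by ring
    exact le_of_mul_le_mul_right h' (by positivity)
  have hKs : 0 < K / s ^ 12 := by positivity
  calc (Nm * s ^ 2) ^ 2 / ((s ^ 16 * Nm) ^ 2 * ν) * t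
      = t / (s ^ 28 * ν) := by field_simp
    _ ≤ (J * P / ν) / (s ^ 28 * ν) := div_le_div_of_nonneg_right ht (by positivity)
    _ = (J * P) / (s ^ 28 * ν ^ 2) := by field_simp
    _ ≤ (J * P) / (s ^ 28 * (K / s ^ 12) ^ 2) := by
        apply div_le_div_of_nonneg_left (mul_nonneg hJ hP) (by positivity)
        exact mul_le_mul_of_nonneg_left (pow_le_pow_left₀ hKs.le hKν 2) (by positivity)
    _ = J * P / (K ^ 2 * s ^ 4) := by field_simp

/-- One window at (T5)'s scale (`J = s = ρ^{-1/16}` periods): `L²/(n²ν)·t ≤ P/(K²s³) = P·ρ^{3/16}/K²` — the lead's `≲ ρ^{3/16}`, `a = 3/16`. -/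
theorem activeBand_exponent_le_T5 {s Nm K ν P t : ℝ} (hs : 1 ≤ s) (hNm : 0 < Nm) (hK : 0 < K) (hν : 0 < ν) (hP : 0 ≤ P)
    (hT3 : K * s ^ 4 ≤ s ^ 16 * ν) (ht : t ≤ s * P / ν) :
    (Nm * s ^ 2) ^ 2 / ((s ^ 16 * Nm) ^ 2 * ν) * t ≤ P / (K ^ 2 * s ^ 3) := by
  have hs0 : 0 < s := lt_of_lt_of_le one_pos hs
  have h := activeBand_exponent_le hs hNm hK hν hP hs0.le hT3 ht
  calc (Nm * s ^ 2) ^ 2 / ((s ^ 16 * Nm) ^ 2 * ν) * t ≤ s * P / (K ^ 2 * s ^ 4) := h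
    _ = P / (K ^ 2 * s ^ 3) := by field_simp

/-- … hence the growth factor of (F_T) is uniformly close to `1` beyond some level: within `J` periods on the active band,
`exp(C·(L²/(n²ν))·t) ≤ exp(C·J·P·ρ^{1/4}/K²)` (`C ≥ 0`). -/
theorem activeBand_growth_le {s Nm K ν P J t C : ℝ} (hs : 1 ≤ s) (hNm : 0 < Nm) (hK : 0 < K) (hν : 0 < ν) (hP : 0 ≤ P) (hJ : 0 ≤ J)
    (hC : 0 ≤ C) (hT3 : K * s ^ 4 ≤ s ^ 16 * ν) (ht : t ≤ J * P / ν) :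
    Real.exp (C * ((Nm * s ^ 2) ^ 2 / ((s ^ 16 * Nm) ^ 2 * ν)) * t) ≤ Real.exp (C * (J * P / (K ^ 2 * s ^ 4))) := by
  rw [Real.exp_le_exp, mul_assoc]
  exact mul_le_mul_of_nonneg_left (activeBand_exponent_le hs hNm hK hν hP hJ hT3 ht) hC

/-- WHOLE SLOW BAND IS NOT SMALL (the caveat, as an identity): at the clause's band edge `L = n·ν/K` the variable part is `ν·t/K²` — of order
`J·P/K²` after `J` periods, with NO power of `ρ`; (F_T) carries no information there. -/
theorem slowBandEdge_exponent_eq {n ν K t : ℝ} (hn : 0 < n) (hν : 0 < ν) (hK : 0 < K) :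
    (n * ν / K) ^ 2 / (n ^ 2 * ν) * t = ν * t / K ^ 2 := by
  field_simp

end

end Summit.AnomalousDissipation.AnomalousDissipation.Cruxes.LagrangianRenormalisationStep.CellEnergyFRecut
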